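import Literature.Computability.Complexity.ClauseTableChecker
import Literature.Computability.Complexity.ExpClockAffine
import Literature.Computability.Complexity.Williams2014TransferProofs
import HarnessLib

/-!
# Williams' Thm. 5.1 from Thm. 5.2: succinct satisfying assignments from universal witness circuits

Literature / circuit complexity (serves `williams_acc` through `Williams2014Transfer.lean`). That
file vendors two leaves of Williams 2014, §5: `Williams2014_thm_5_2` — **universal witness
circuits** (Impagliazzo–Kabanets–Wigderson 2002): under `NEXP ⊆ P/poly` every language of `NEXP`
has, for every correct exponential-time verifier, witnesses that are prefixes of truth tables of
polynomial-size circuits — and `Williams2014_thm_5_1` — **succinct satisfying assignments** for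
every succinct reduction — with the remark of the source (p. 17) that "Theorem 5.1 is not
explicitly proved in the paper, however it follows immediately from another theorem. […] The
following directly implies Theorem 5.1: Theorem 5.2". This file PROVES that implication in the
tree's model:

* `exists_clauseTableVerifier` — for `L ∈ NTIME(2ⁿ)` with a succinct reduction `cl` (constant `c`),
  a correct `2^{n³}`-time verifier (`NVerifier`) whose accepted witnesses are exactly the
  assignment TABLES `y` of length `2 ^ m(n)`, `m(n) = (c + 1) n² + c` (`tableExp`), satisfying
  the presented formula `succinctCNF c cl x` (read as "variable `v` is true iff `y[v] = 1`",
  `tableAssignment`): the machine is the truncating wrapper `truncMapAux`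
  (`TruncMapMachine.lean`) for the exponential clock `x ↦ ⟨x, 1^{2^{m(n)} + 1}⟩`
  (`expClockGen 1 1 (c+1) 2 c`, `ExpClockAffine.lean`; one symbol more than a table, so that
  the kept witness `y ↾ (2^{m(n)} + 1)` has length `2^{m(n)}` iff `y` has) followed by the
  polynomial-time clause-table checker `ClauseCheck.checkFn` (`ClauseTableChecker.lean`);
* `exists_restrict_inputs` / the LSB-first bookkeeping `boolFunEquivFin_symm_apply`: a circuit whose
  truth table starts with the table `y` is cut down to `succinctWidth c n` inputs by
  hard-wiring its high inputs to `0` (`Circuit.exists_hardwire`), and then ENCODES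
  (`Circuit.assignment`) the table's assignment on all variables `< 2 ^ succinctWidth c n`;
* **`Williams2014_thm_5_1_of_thm_5_2 : Williams2014_thm_5_2 → Williams2014_thm_5_1`** and the
  corollary `williams_acc_of_ikw_components` — Williams' Thm. 1.1 from exactly Fact 3.1,
  Thm. 5.2 (IKW), Thm. 3.2/Lemma 3.1, the hierarchy theorem and the `ACC`-SAT algorithm.

## References

* R. Williams, *Nonuniform ACC circuit lower bounds*, J. ACM 61 (2014), §5, Thm. 5.1, Thm. 5.2
  ("The following directly implies Theorem 5.1").
* R. Impagliazzo, V. Kabanets, A. Wigderson, *In search of an easy witness*, JCSS 65 (2002).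
* S. Arora, B. Barak, *Computational Complexity: A Modern Approach*, CUP 2009, Def. 2.1, §6.1.
-/

namespace Literature.Computability.Complexity

open _root_.Computability Turing Polynomial Brick ClauseCheck

/-! ### Evaluation of formulas depends only on occurring variables -/

/-- Two assignments agreeing on the variables of a clause give it the same value (the `CNF`/`Clause`
counterpart of `PropForm.eval_congr`, `TautCertificates.lean`). [folklore] -/
theorem Clause.eval_congr {C : Clause ℕ} {σ τ : ℕ → Bool} (h : ∀ l ∈ C, σ l.1 = τ l.1) :
    Clause.eval σ C = Clause.eval τ C := by
  induction C with
  | nil => rfl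
  | cons l C ih =>
    simp only [Clause.eval, List.any_cons] at ih ⊢
    rw [ih (fun l' hl' => h l' (List.mem_cons_of_mem _ hl')), Literal.eval, Literal.eval,
      h l (List.mem_cons_self)]

/-- Two assignments agreeing below `2 ^ succinctWidth c |x|` give the presented formula of a
succinct reduction the same value (its variables are that small, `IsSuccinctReduction.var_lt`).
[folklore] -/
theorem eval_succinctCNF_congr {c : ℕ} {L : Language Bool} {cl : List Bool → ℕ → Clause ℕ}
    (hred : IsSuccinctReduction c L cl) (x : List Bool) {σ τ : ℕ → Bool}
    (h : ∀ v < 2 ^ succinctWidth c x.length, σ v = τ v) :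
    (succinctCNF c cl x).eval σ = (succinctCNF c cl x).eval τ := by
  rw [Bool.eq_iff_iff, eval_succinctCNF_eq_true_iff, eval_succinctCNF_eq_true_iff]
  have hc : ∀ i, Clause.eval σ (cl x i) = Clause.eval τ (cl x i) := fun i =>
    Clause.eval_congr fun l hl => h l.1 (hred.var_lt x i l hl)
  simp only [hc]

/-! ### The table of an assignment -/

/-- The table of `σ` below `N`: the `N`-bit string `σ 0, σ 1, …`. [folklore] -/
def tableOf (σ : ℕ → Bool) (N : ℕ) : List Bool := List.ofFn fun i : Fin N => σ i

/-- Length of a table. [folklore] -/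
@[simp] theorem length_tableOf (σ : ℕ → Bool) (N : ℕ) : (tableOf σ N).length = N := by
  simp [tableOf]

/-- Reading a table back below its length. [folklore] -/
theorem tableAssignment_tableOf {σ : ℕ → Bool} {N v : ℕ} (hv : v < N) :
    tableAssignment (tableOf σ N) v = σ v := by
  simp [tableAssignment, tableOf, hv]

/-! ### The clause-table verifier -/

/-- The relation of the clause-table verifier: the kept witness `y ↾ (2^{m(n)} + 1)` is a table of
length `2^{m(n)}` under which every clause of the presented formula passes the brick test.
[folklore] -/
def clauseTableRel (c : ℕ) (cl : List Bool → ℕ → Clause ℕ) (x y : List Bool) : Bool :=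
  let y' := y.take (2 ^ tableExp c x.length + 1)
  decide (y'.length = 2 ^ tableExp c x.length ∧
    ∀ i < 2 ^ succinctWidth c x.length, clauseHolds y' (cl x i) = true)

/-- The length trick: `|y ↾ (N + 1)| = N ↔ |y| = N`. [folklore] -/
theorem length_take_succ_eq_iff (y : List Bool) (N : ℕ) : (y.take (N + 1)).length = N ↔ y.length = N := by
  rw [List.length_take]
  omega

/-- **Semantics of the relation**: for a succinct reduction, the verifier accepts `(x, y)` iff `y`
is a table of length `2^{m(n)}` whose assignment satisfies the presented formula. [folklore] -/
theorem clauseTableRel_eq_true_iff {c : ℕ} {L : Language Bool} {cl : List Bool → ℕ → Clause ℕ}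
    (hred : IsSuccinctReduction c L cl) (x y : List Bool) :
    clauseTableRel c cl x y = true ↔ y.length = 2 ^ tableExp c x.length ∧
      (succinctCNF c cl x).eval (tableAssignment y) = true := by
  simp only [clauseTableRel, decide_eq_true_eq, length_take_succ_eq_iff]
  constructor
  · rintro ⟨hlen, hall⟩
    have hy : y.take (2 ^ tableExp c x.length + 1) = y := List.take_of_length_le (by omega)
    rw [hy] at hall
    refine ⟨hlen, eval_succinctCNF_eq_true_iff.2 fun i hi => ?_⟩
    rw [← clauseHolds_eq_eval y (hred.length_le x i)]
    exact hall i hi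
  · rintro ⟨hlen, hev⟩
    have hy : y.take (2 ^ tableExp c x.length + 1) = y := List.take_of_length_le (by omega)
    rw [hy]
    refine ⟨hlen, fun i hi => ?_⟩
    rw [clauseHolds_eq_eval y (hred.length_le x i)]
    exact eval_succinctCNF_eq_true_iff.1 hev i hi

/-- `n ≤ m(n)`. [folklore] -/
theorem le_tableExp (c n : ℕ) : n ≤ tableExp c n :=
  (le_succinctWidth c n).trans (succinctWidth_le_tableExp c n)

/-- **Exponential domination**: a polynomial in `2^{m(n)}`, `m(n) = (c + 1) n² + c`, is
`≤ K · 2^{n³} + K`. [folklore] -/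
theorem exists_poly_two_pow_tableExp_le (c : ℕ) (Q : Polynomial ℕ) :
    ∃ K : ℕ, ∀ n : ℕ, Q.eval (2 ^ tableExp c n) ≤ K * 2 ^ (n ^ 3) + K := by
  obtain ⟨a, d, ha⟩ := exists_eval_le_mul_pow_add Q
  -- beyond `n₀`, `d · m(n) ≤ n³`
  set n₀ := d * (c + 1) + d * c + 1 with hn₀
  have hlarge : ∀ n, n₀ ≤ n → d * tableExp c n ≤ n ^ 3 := by
    intro n hn
    have h1 : 1 ≤ n := by omega
    unfold tableExp
    have h2 : d * ((c + 1) * n ^ 2 + c) ≤ (d * (c + 1) + d * c) * n ^ 2 := by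
      have : c ≤ c * n ^ 2 := Nat.le_mul_of_pos_right c (by positivity)
      nlinarith
    calc d * ((c + 1) * n ^ 2 + c) ≤ (d * (c + 1) + d * c) * n ^ 2 := h2
      _ ≤ n * n ^ 2 := Nat.mul_le_mul_right _ (by omega)
      _ = n ^ 3 := by ring
  refine ⟨a + ∑ i ∈ Finset.range n₀, (a * (2 ^ tableExp c i) ^ d + a), fun n => ?_⟩
  set S := ∑ i ∈ Finset.range n₀, (a * (2 ^ tableExp c i) ^ d + a) with hS
  rcases lt_or_ge n n₀ with hn | hn
  · have h1 : a * (2 ^ tableExp c n) ^ d + a ≤ S :=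
      Finset.single_le_sum (f := fun i => a * (2 ^ tableExp c i) ^ d + a)
        (fun _ _ => Nat.zero_le _) (Finset.mem_range.2 hn)
    calc Q.eval (2 ^ tableExp c n) ≤ a * (2 ^ tableExp c n) ^ d + a := ha _
      _ ≤ S := h1
      _ ≤ (a + S) * 2 ^ (n ^ 3) + (a + S) := by nlinarith [Nat.one_le_two_pow (n := n ^ 3)]
  · have h2 : (2 ^ tableExp c n) ^ d ≤ 2 ^ (n ^ 3) := by
      rw [← pow_mul, mul_comm]
      exact Nat.pow_le_pow_right Nat.two_pos (hlarge n hn)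
    calc Q.eval (2 ^ tableExp c n) ≤ a * (2 ^ tableExp c n) ^ d + a := ha _
      _ ≤ a * 2 ^ (n ^ 3) + a := by gcongr
      _ ≤ (a + S) * 2 ^ (n ^ 3) + (a + S) := by nlinarith [Nat.zero_le (S * 2 ^ (n ^ 3))]

/-- **The clause-table verifier** of `L ∈ NTIME(2ⁿ)` along a succinct reduction: a correct
`2^{n³}`-time verifier whose relation is `clauseTableRel c cl` (the verifier to which Thm. 5.2
is applied in the derivation of Thm. 5.1; Williams 2014, p. 4: "evaluating `W` on all possible
assignments encodes a satisfying assignment to the exponentially long `F_{Cₓ}`"). Machine: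
`truncMapAux` for the clock `x ↦ ⟨x, 1^{2^{m(n)}+1}⟩` (`expClockGen 1 1 (c+1) 2 c`), then the
clause-table checker. [cite: Williams2014, §5, p. 17 (Thm. 5.1 from Thm. 5.2)] -/
theorem exists_clauseTableVerifier {c : ℕ} {L : Language Bool} {cl : List Bool → ℕ → Clause ℕ}
    (hred : IsSuccinctReduction c L cl) :
    ∃ V : NVerifier (fun n => 2 ^ (n ^ 3)) L, V.rel = clauseTableRel c cl := by
  -- the checker machine
  obtain ⟨p, Mchk, hMchk⟩ :=
    ClauseCheck.checkFn_mem_FP c cl hred.polyTimeComputable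
  -- the clock machine (exponent `(c + 1) n² + c`, one extra symbol)
  obtain ⟨C₀, Nc, hNc⟩ := exists_timeComputable_expClockGen 1 1 c (a := c + 1) (k := 2)
    (by norm_num) (Nat.succ_pos c)
  -- domination
  obtain ⟨K, hK⟩ := exists_poly_two_pow_tableExp_le c
    (p.comp (6 * X) + Polynomial.C C₀ * X + Polynomial.C C₀ + 8 * X + 13)
  let V : TM2ComputableAux Bool Bool := (truncMapAux Nc).comp Mchk
  refine ⟨⟨2 * K + 2, clauseTableRel c cl, V, fun x y hy => ?_, fun x => ?_⟩, rfl⟩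
  · -- running time
    set N := 2 ^ tableExp c x.length with hN
    have hclock : Nc.OutputsWithin x (boolPair x (List.replicate (N + 1) true)) (C₀ * N + C₀) := by
      have := hNc x
      simpa [expClockGen, hN, tableExp] using this
    have h₁ := outputsWithin_truncMapAux_boolPair Nc (y := y) hclock
    simp only [List.length_replicate] at h₁
    set y' := y.take (N + 1) with hy'
    have hchk : Mchk.OutputsWithin (boolPair x y') (encodeBool (clauseTableRel c cl x y))
        (p.eval (boolPair x y').length) := by
      have h := hMchk (boolPair x y')
      rw [ClauseCheck.checkFn_boolPair] at h
      have he : encodeBool (clauseTableRel c cl x y) = [clauseTableRel c cl x y] := by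
        cases clauseTableRel c cl x y <;> rfl
      rw [he]
      simpa [clauseTableRel, hN, hy'] using h
    have h := Turing.TM2ComputableAux.comp_outputsWithin _ _ h₁ hchk
    refine h.mono ?_
    -- estimates
    have hn : x.length ≤ N := (le_tableExp c x.length).trans Nat.lt_two_pow_self.le
    have hN1 : 1 ≤ N := Nat.one_le_two_pow
    have hlen' : (boolPair x y').length ≤ 6 * N := by
      rw [length_boolPair]
      have : y'.length ≤ N + 1 := List.length_take_le _ _
      omega
    have hp : p.eval (boolPair x y').length ≤ p.eval (6 * N) := natPoly_eval_mono p hlen'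
    have hKn := hK x.length
    simp only [eval_add, eval_mul, eval_comp, eval_X, eval_C, eval_ofNat, ← hN] at hKn
    have hy2 : 2 * (y.length / 2) ≤ (2 * K + 2) * 2 ^ (x.length ^ 3) + (2 * K + 2) :=
      (Nat.mul_div_le y.length 2).trans hy
    nlinarith [hp, hKn, hy2, hn, hN1]
  · -- correctness
    rw [hred.mem_iff x]
    constructor
    · rintro ⟨σ, hσ⟩
      refine ⟨tableOf σ (2 ^ tableExp c x.length), ?_, ?_⟩
      · have hKn := hK x.length
        simp only [eval_add, eval_mul, eval_comp, eval_X, eval_C, eval_ofNat] at hKn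
        rw [length_tableOf]
        have h8 : 8 * 2 ^ tableExp c x.length ≤ K * 2 ^ (x.length ^ 3) + K :=
          ((Nat.le_add_left _ _).trans (Nat.le_add_right _ 13)).trans hKn
        calc 2 ^ tableExp c x.length ≤ 8 * 2 ^ tableExp c x.length := Nat.le_mul_of_pos_left _ (by norm_num)
          _ ≤ K * 2 ^ (x.length ^ 3) + K := h8
          _ ≤ (2 * K + 2) * 2 ^ (x.length ^ 3) + (2 * K + 2) :=
              Nat.add_le_add (Nat.mul_le_mul_right _ (by omega)) (by omega)
      · rw [clauseTableRel_eq_true_iff hred, length_tableOf]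
        refine ⟨rfl, ?_⟩
        rw [eval_succinctCNF_congr hred x (τ := σ) fun v hv => tableAssignment_tableOf
          (hv.trans_le (Nat.pow_le_pow_right Nat.two_pos (succinctWidth_le_tableExp c _)))]
        exact hσ
    · rintro ⟨y, -, hy⟩
      rw [clauseTableRel_eq_true_iff hred] at hy
      exact ⟨_, hy.2⟩

/-! ### Cutting a witness circuit down to the index width -/

/-- **LSB-first bookkeeping**: the `i`-th coordinate of the `v`-th point of the Boolean cube in the
tree's enumeration is the `i`-th binary digit of `v` (`MetaComplexity.boolFunEquivFin` is built
from `finFunctionFinEquiv`, digits least significant first). [folklore] -/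
theorem boolFunEquivFin_symm_apply (n v : ℕ) (h : v < 2 ^ n) (i : Fin n) :
    (MetaComplexity.boolFunEquivFin n).symm ⟨v, h⟩ i = v.testBit i := by
  simp only [MetaComplexity.boolFunEquivFin, Equiv.symm_trans_apply, Equiv.arrowCongr_symm,
    Equiv.arrowCongr_apply, Equiv.refl_symm, Equiv.coe_refl, Function.comp_apply, id,
    Equiv.symm_symm]
  rw [Nat.testBit_eq_decide_div_mod_eq, Bool.eq_iff_iff]
  have hv : ((finFunctionFinEquiv.symm ⟨v, h⟩ i : Fin 2) : ℕ) = v / 2 ^ (i : ℕ) % 2 :=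
    finFunctionFinEquiv_symm_apply_val ⟨v, h⟩ i
  generalize finFunctionFinEquiv.symm ⟨v, h⟩ i = b at hv
  fin_cases b
  · simp at hv; simp [finTwoEquiv]; omega
  · simp at hv; simp [finTwoEquiv]; omega

/-- The truth table of a circuit, read at `v`, is its value at the `v`-th cube point. [folklore] -/
theorem getElem_truthTable {m : ℕ} (W : Circuit (Fin m)) {v : ℕ}
    (hv : v < (MetaComplexity.truthTable W.eval).length) :
    (MetaComplexity.truthTable W.eval)[v] =
      W.eval ((MetaComplexity.boolFunEquivFin m).symm ⟨v, by simpa using hv⟩) := by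
  simp [MetaComplexity.truthTable]

/-- **Hard-wiring the high inputs**: a `B₂`-circuit `W` on `m` inputs, `w ≤ m`, becomes a
`B₂`-circuit on `w` inputs with at most two more gates whose value at the `v`-th point of
`{0,1}ʷ`, `v < 2ʷ`, is the value of `W` at the `v`-th point of `{0,1}ᵐ` (inputs `≥ w` set to
`0`; `Circuit.exists_hardwire`). [folklore] -/
theorem exists_restrict_inputs {m w : ℕ} (hwm : w ≤ m) (W : Circuit (Fin m)) (hW : W.IsOver B2) :
    ∃ W' : Circuit (Fin w), W'.IsOver B2 ∧ W'.size ≤ W.size + 2 ∧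
      ∀ (v : ℕ) (hv : v < 2 ^ w),
        W'.eval ((MetaComplexity.boolFunEquivFin w).symm ⟨v, hv⟩) =
          W.eval ((MetaComplexity.boolFunEquivFin m).symm
            ⟨v, hv.trans_le (Nat.pow_le_pow_right Nat.two_pos hwm)⟩) := by
  let σ : Fin m → Fin w ⊕ Bool := fun j => if h : (j : ℕ) < w then Sum.inl ⟨j, h⟩ else Sum.inr false
  obtain ⟨D, hDB, hDs, -, hDe⟩ := Circuit.exists_hardwire (B := B2) (by simp [B2, GateFn.or])
    (by simp [B2, GateFn.and]) W hW σ
  refine ⟨D, hDB, hDs, fun v hv => ?_⟩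
  rw [hDe]
  congr 1
  funext j
  rw [boolFunEquivFin_symm_apply]
  by_cases hj : (j : ℕ) < w
  · simp only [σ, hj, dite_true, Sum.elim_inl]
    exact boolFunEquivFin_symm_apply w v hv ⟨j, hj⟩
  · simp only [σ, hj, dite_false, Sum.elim_inr, id]
    symm
    exact Nat.testBit_eq_false_of_lt (hv.trans_le (Nat.pow_le_pow_right Nat.two_pos (Nat.le_of_not_lt hj)))

/-! ### Theorem 5.1 from Theorem 5.2 -/

/-- **Williams 2014, Thm. 5.1 from Thm. 5.2** (p. 17: "Theorem 5.1 is not explicitly proved in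
the paper, however it follows immediately from another theorem. […] The following directly
implies Theorem 5.1: Theorem 5.2"): universal witness circuits for the clause-table verifier of
a succinct reduction are, after hard-wiring their high inputs, polynomial-size circuits on
`succinctWidth c n` inputs encoding satisfying assignments of the presented formulas.
[cite: Williams2014, Thm. 5.1 and Thm. 5.2, p. 17] -/
theorem Williams2014_thm_5_1_of_thm_5_2 (h52 : Williams2014_thm_5_2) : Williams2014_thm_5_1 := by
  intro hNEXP c L cl hL hred
  obtain ⟨V, hV⟩ := exists_clauseTableVerifier hred
  obtain ⟨c₅, hc₅⟩ := h52 hNEXP L (NTIME_two_pow_subset_NEXP hL) 3 V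
  refine ⟨c₅ + 3, fun x hx => ?_⟩
  obtain ⟨m, W, y, hWB, hWs, -, hrel, hpre⟩ := hc₅ x hx
  rw [hV, clauseTableRel_eq_true_iff hred] at hrel
  obtain ⟨hylen, hsat⟩ := hrel
  set n := x.length with hn
  set w := succinctWidth c n with hw
  -- the witness circuit has at least `m(n) ≥ w` inputs
  have hlenle : y.length ≤ (MetaComplexity.truthTable W.eval).length := hpre.length_le
  rw [MetaComplexity.length_truthTable, hylen] at hlenle
  have hmw : w ≤ m := by
    have h1 : tableExp c n ≤ m := (Nat.pow_le_pow_iff_right (by norm_num)).1 hlenle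
    exact (succinctWidth_le_tableExp c n).trans h1
  obtain ⟨W', hW'B, hW's, hW'e⟩ := exists_restrict_inputs hmw W hWB
  refine ⟨w, W', le_rfl, hW'B, ?_, ?_⟩
  · -- size `≤ n ^ (c₅ + 3) + (c₅ + 3)`
    have h1 : W'.size ≤ n ^ c₅ + c₅ + 2 := hW's.trans (by omega)
    rcases Nat.eq_zero_or_pos n with h0 | hpos
    · rw [h0] at h1 ⊢
      rcases Nat.eq_zero_or_pos c₅ with rfl | hc
      · simp at h1 ⊢; omega
      · rw [Nat.zero_pow hc] at h1
        rw [Nat.zero_pow (by omega)]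
        omega
    · have h2 : n ^ c₅ ≤ n ^ (c₅ + 3) := Nat.pow_le_pow_right hpos (by omega)
      omega
  · -- the encoded assignment agrees with the table below `2 ^ w`
    rw [eval_succinctCNF_congr hred x (σ := W'.assignment) (τ := tableAssignment y) fun v hv => ?_]
    · exact hsat
    · have hvy : v < y.length := by
        rw [hylen]
        exact hv.trans_le (Nat.pow_le_pow_right Nat.two_pos (succinctWidth_le_tableExp c n))
      have hvt : v < (MetaComplexity.truthTable W.eval).length := by
        rw [MetaComplexity.length_truthTable]
        exact hv.trans_le (Nat.pow_le_pow_right Nat.two_pos hmw)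
      rw [Circuit.assignment_of_lt W' hv, hW'e v hv, ← getElem_truthTable W hvt]
      rw [tableAssignment, decide_eq_true hvy, Bool.true_and, List.getD_eq_getElem _ _ hvy]
      exact (hpre.getElem hvy).symm

/-- **Williams' Theorem 1.1 from the IKW leaf**: Fact 3.1, Thm. 5.2 (universal witness
circuits, Impagliazzo–Kabanets–Wigderson), Thm. 3.2 with Lemma 3.1, the nondeterministic time
hierarchy theorem and the `ACC`-SAT algorithm of Thm. 4.1 imply `williams_acc`; the inclusions
`P ⊆ NTIME(2ⁿ)`, `ACC⁰ ⊆ P/poly`, the padding translation and now Thm. 5.1 are theorems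
(`Williams2014TransferProofs.lean`, this file). [cite: Williams2014, Thm. 1.1 and its proof] -/
theorem williams_acc_of_ikw_components (h31 : Williams2014_fact_3_1) (h52 : Williams2014_thm_5_2)
    (h32 : Williams2014_thm_3_2) (hH : ntime_hierarchy) (h41 : Williams2014_accSat_polysize) :
    williams_acc :=
  williams_acc_of_deep_components h31 (Williams2014_thm_5_1_of_thm_5_2 h52) h32 hH h41

end Literature.Computability.Complexity
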